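import Mathlib.MeasureTheory.Integral.IntegralEqImproper
import Mathlib.MeasureTheory.Integral.DominatedConvergence
import Mathlib.Analysis.SpecialFunctions.SmoothTransition
import Mathlib.Analysis.SpecialFunctions.Log.Deriv
import Mathlib.Analysis.Calculus.LocalExtr.Basic
import HarnessLib

/-!
# Schoen–Yau 1979, §2, Step 3: the logarithmic cut-off argument

Schoen–Yau, *On the proof of the positive mass conjecture in general relativity*, Comm. Math.
Phys. 65 (1979), §2, Step 3 (pp. 52–55) shows that the complete area-minimising surface `S` of
Step 2 has finite total curvature and `0 < ½ ∫_S (R + ‖A‖²) ≤ ∫_S K` ((2.18)), before the Claim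
`∫_S K ≤ 0` (pp. 55–63) produces the contradiction proving Theorem 1
(`schoenYau_mass_nonneg`, whose remaining hypothesis `h₂₃` in
`PositiveMassSchoenYauReduction.lean` is exactly Steps 2–3). The passage from the stability
inequality to (2.16)–(2.18) is *measure theory on `S`* once four geometric inputs are isolated —
quadratic area growth (2.9), the stability inequality (2.13)/(2.15) tested against radial
cut-offs, the decay `K₁₂ = O(r⁻³)` of the ambient sectional curvature, and `R > 0` far out — and
this file proves that passage in abstract form, on a measure space `(S, μ)` (the surface with
its area measure) carrying an exhaustion function `ρ ≥ 1` (the extended coordinate radius `r'`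
of p. 52):

* `SchoenYau.logCutoff n` — the printed logarithmic cut-off of p. 54 (`φ = 1` on `S(σ)`,
  `log(σ²/r)/log σ` on `S(σ²) ∖ S(σ)`, `0` outside `S(σ²)`) in a smooth dyadic form
  (`σ = 2ⁿ`, a smooth plateau profile `SchoenYau.plateau` in the variable `log r/log σ`):
  smooth (`logCutoff_contDiff`), `= 1` below `2ⁿ`, `= 0` above `4ⁿ`, values in `[0, 1]`,
  `|φ_n'(t)| ≤ c₁/(n log 2 · t)` (`abs_deriv_logCutoff_le`, `deriv_logCutoff_sq_le`).
* `SchoenYau.integral_shell_inv_sq_le` — **(2.11)**, dyadic form: quadratic area growth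
  `μ{ρ ≤ t} ≤ C t²` (`t ≥ 1`) gives `∫ ρ⁻² 𝟙_{2ⁿ < ρ < 4ⁿ} dμ ≤ 4 C n`; hence the cut-off energy
  `∫ φ_n'(ρ)² dμ ≤ (4 C c₁²/(log 2)²)/n → 0` (`integral_deriv_logCutoff_sq_le`; p. 54).
* `SchoenYau.integrable_inv_cube` — **(2.10)** (`a = 3`): `∫ ρ⁻³ dμ ≤ 8 C < ∞`.
* `SchoenYau.integrable_and_integral_le_of_stability` — **the cut-off argument**: if `P ≥ 0` is
  locally integrable along the exhaustion, `Q` is integrable, and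
  `∫ (P − Q) η(ρ)² dμ ≤ Λ ∫ η'(ρ)² dμ` for all smooth `η : ℝ → [0, 1]` with `η = 1` on `(-∞, 1]`
  and `η = 0` on some `[T, ∞)`, then `P ∈ L¹(μ)` and `∫ P ≤ ∫ Q` ("letting `σ → ∞`", pp. 54–55).
* `SchoenYau.integral_gauss_curvature_pos_of_stability` (and the primed version with the
  printed decay hypothesis `|K + ‖A‖²/2| ≤ Λ' ρ⁻³`) — **(2.15) ⟹ (2.16), (2.17), (2.18)**: with
  `R ≥ 0`, `a = ‖A‖² ≥ 0` locally integrable, `K + a/2` integrable (`= K₁₂` by the Gauss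
  equation (2.14) and minimality (2.12)), and (2.15) against radial test functions:
  `a, K, R ∈ L¹`, `½ ∫ (R + a) ≤ ∫ K`, and `0 < ½ ∫ (R + a)` as soon as `μ{R > 0} ≠ 0`.

Everything here is proved; the two definitions (`plateau`, `logCutoff`) have bodies. What a
formalisation of Step 3 must still supply to instantiate these statements on the surface `S`
of Step 2 is geometric: the area bound (2.9) from the minimising property, the stability
inequality (2.13) (second variation of area) combined with the traced Gauss equation (2.14)
(in the tree: `PseudoRiemannianMetric.scalarCurvature_inducedMetric_eq`,
`TracedGaussEquation.lean`) into (2.15), the bound `‖∇_S r'‖² ≤ C₃` and the decay of `K₁₂`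
from (1.1), and that `S` meets the region `{R > 0}` in positive area; and then Remark 2.1
(Cohn-Vossen) and the Claim `∫_S K ≤ 0` (Huber/Finn or Gauss–Bonnet with boundary,
(2.19)–(2.42)), for which neither Mathlib nor the tree has the surface theory yet.

## References

* R. Schoen, S.-T. Yau, *On the proof of the positive mass conjecture in general relativity*,
  Comm. Math. Phys. 65 (1979) 45–76: §2, Step 3, (2.9)–(2.18) (pp. 52–55). [SchoenYauPMT1979]
-/

noncomputable section

open Set Filter MeasureTheory Topology Real
open scoped ContDiff

namespace Literature.Geometry.Lorentzian

namespace SchoenYau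

/-! ### A fixed smooth plateau profile `χ` : `1` on `(-∞, 1]`, `0` on `[2, ∞)` -/

/-- The plateau profile `χ(s) = 1 − S(s − 1)`, `S = Real.smoothTransition`: smooth, `χ = 1` on
`(-∞, 1]`, `χ = 0` on `[2, ∞)`, values in `[0, 1]`. [folklore] -/
def plateau (s : ℝ) : ℝ := 1 - Real.smoothTransition (s - 1)

/-- `χ` is smooth. [folklore] -/
theorem plateau_contDiff : ContDiff ℝ ∞ plateau :=
  contDiff_const.sub (Real.smoothTransition.contDiff.comp (contDiff_id.sub contDiff_const))

/-- `χ = 1` on `(-∞, 1]`. [folklore] -/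
theorem plateau_of_le_one {s : ℝ} (hs : s ≤ 1) : plateau s = 1 := by
  unfold plateau
  rw [Real.smoothTransition.zero_of_nonpos (by linarith), sub_zero]

/-- `χ = 0` on `[2, ∞)`. [folklore] -/
theorem plateau_of_two_le {s : ℝ} (hs : 2 ≤ s) : plateau s = 0 := by
  unfold plateau
  rw [Real.smoothTransition.one_of_one_le (by linarith), sub_self]

/-- `0 ≤ χ`. [folklore] -/
theorem plateau_nonneg (s : ℝ) : 0 ≤ plateau s := by
  unfold plateau
  linarith [Real.smoothTransition.le_one (s - 1)]

/-- `χ ≤ 1`. [folklore] -/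
theorem plateau_le_one (s : ℝ) : plateau s ≤ 1 := by
  unfold plateau
  linarith [Real.smoothTransition.nonneg (s - 1)]

/-- `χ' = 0` on `(-∞, 1]` and on `[2, ∞)`: `χ` attains its maximum `1` at every `s ≤ 1` and its
minimum `0` at every `s ≥ 2`. [folklore] -/
theorem deriv_plateau_eq_zero {s : ℝ} (hs : s ≤ 1 ∨ 2 ≤ s) : deriv plateau s = 0 := by
  rcases hs with hs | hs
  · apply IsLocalMax.deriv_eq_zero
    filter_upwards with t
    rw [plateau_of_le_one hs]
    exact plateau_le_one t
  · apply IsLocalMin.deriv_eq_zero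
    filter_upwards with t
    rw [plateau_of_two_le hs]
    exact plateau_nonneg t

/-- A bound `|χ'| ≤ c₁` (continuity of `χ'` on the compact `[1, 2]`, `χ' = 0` elsewhere).
[folklore] -/
theorem exists_bound_deriv_plateau : ∃ c : ℝ, 0 ≤ c ∧ ∀ s, |deriv plateau s| ≤ c := by
  have hc : Continuous (deriv plateau) := plateau_contDiff.continuous_deriv (by simp)
  obtain ⟨c, hc⟩ := isCompact_Icc.exists_bound_of_continuousOn (hc.continuousOn (s := Icc 1 2))
  refine ⟨max c 0, le_max_right _ _, fun s ↦ ?_⟩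
  by_cases hs : s ∈ Icc (1 : ℝ) 2
  · exact ((Real.norm_eq_abs _).symm.le.trans (hc s hs)).trans (le_max_left _ _)
  · rw [mem_Icc, not_and_or, not_le, not_le] at hs
    rw [deriv_plateau_eq_zero (hs.imp le_of_lt le_of_lt), abs_zero]
    exact le_max_right _ _

/-! ### The dyadic logarithmic cut-offs `φ_n` -/

/-- **Schoen–Yau's logarithmic cut-off, smooth dyadic form.** Schoen–Yau 1979, p. 54, use on
the minimal surface `S` the Lipschitz cut-off `φ = 1` on `S(σ)`, `φ = log(σ²/r)/log σ` on
`S(σ²) ∖ S(σ)`, `φ = 0` outside `S(σ²)`. Here, with `σ = 2ⁿ` and the radius as a real variable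
`t`, `logCutoff n t = χ(log t /(n log 2))` for `t > 0` (and `1` for `t ≤ 0`), `χ = plateau`:
a smooth function of `t`, equal to `1` for `t ≤ 2ⁿ`, to `0` for `t ≥ 4ⁿ`, with values in
`[0, 1]` and `|φ_n'(t)| ≤ c₁/(n log 2 · t)` — the two properties of the printed cut-off that the
argument uses. [cite: SchoenYauPMT1979, §2, p. 54] -/
def logCutoff (n : ℕ) (t : ℝ) : ℝ :=
  if 0 < t then plateau (Real.log t / (n * Real.log 2)) else 1

variable {n : ℕ}

/-- The defining formula of `φ_n` on `(0, ∞)`. [folklore] -/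
theorem logCutoff_of_pos {t : ℝ} (ht : 0 < t) :
    logCutoff n t = plateau (Real.log t / (n * Real.log 2)) := if_pos ht

/-- `φ_n` takes values in `[0, 1]`. [folklore] -/
theorem logCutoff_mem_Icc (n : ℕ) (t : ℝ) : logCutoff n t ∈ Icc (0 : ℝ) 1 := by
  unfold logCutoff
  split_ifs
  · exact ⟨plateau_nonneg _, plateau_le_one _⟩
  · exact ⟨zero_le_one, le_rfl⟩

/-- `0 ≤ φ_n`. [folklore] -/
theorem logCutoff_nonneg (n : ℕ) (t : ℝ) : 0 ≤ logCutoff n t := (logCutoff_mem_Icc n t).1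

/-- `φ_n ≤ 1`. [folklore] -/
theorem logCutoff_le_one (n : ℕ) (t : ℝ) : logCutoff n t ≤ 1 := (logCutoff_mem_Icc n t).2

/-- `φ_n = 1` on `(-∞, 2ⁿ]` (`n ≥ 1`). [folklore] -/
theorem logCutoff_of_le_two_pow (hn : 1 ≤ n) {t : ℝ} (ht : t ≤ 2 ^ n) : logCutoff n t = 1 := by
  unfold logCutoff
  split_ifs with h0
  · apply plateau_of_le_one
    have hL : 0 < (n : ℝ) * Real.log 2 := by
      have : (1 : ℝ) ≤ n := by exact_mod_cast hn
      positivity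
    rw [div_le_one hL]
    calc Real.log t ≤ Real.log (2 ^ n) := Real.log_le_log h0 ht
      _ = n * Real.log 2 := by rw [Real.log_pow]
  · rfl

/-- `φ_n = 0` on `[4ⁿ, ∞)` (`n ≥ 1`). [folklore] -/
theorem logCutoff_of_four_pow_le (hn : 1 ≤ n) {t : ℝ} (ht : (4 : ℝ) ^ n ≤ t) :
    logCutoff n t = 0 := by
  have h4 : (0 : ℝ) < 4 ^ n := by positivity
  have h0 : 0 < t := h4.trans_le ht
  rw [logCutoff_of_pos h0]
  apply plateau_of_two_le
  have hL : 0 < (n : ℝ) * Real.log 2 := by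
    have : (1 : ℝ) ≤ n := by exact_mod_cast hn
    positivity
  rw [le_div_iff₀ hL]
  calc 2 * (n * Real.log 2) = Real.log (4 ^ n) := by
        rw [Real.log_pow, show (4 : ℝ) = 2 ^ 2 by norm_num, Real.log_pow]; push_cast; ring
    _ ≤ Real.log t := Real.log_le_log h4 ht

/-- On `(0, ∞)`, `φ_n` is the composition `χ ∘ (log · /(n log 2))`. [folklore] -/
theorem logCutoff_eventuallyEq_of_pos {t : ℝ} (ht : 0 < t) :
    logCutoff n =ᶠ[𝓝 t] fun s ↦ plateau (Real.log s / (n * Real.log 2)) := by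
  filter_upwards [Ioi_mem_nhds ht] with s hs using logCutoff_of_pos hs

/-- Below `2ⁿ`, `φ_n` is locally the constant `1`. [folklore] -/
theorem logCutoff_eventuallyEq_one (hn : 1 ≤ n) {t : ℝ} (ht : t < 2 ^ n) :
    logCutoff n =ᶠ[𝓝 t] fun _ ↦ (1 : ℝ) := by
  filter_upwards [Iio_mem_nhds ht] with s hs using logCutoff_of_le_two_pow hn hs.le

/-- Above `4ⁿ`, `φ_n` is locally the constant `0`. [folklore] -/
theorem logCutoff_eventuallyEq_zero (hn : 1 ≤ n) {t : ℝ} (ht : (4 : ℝ) ^ n < t) :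
    logCutoff n =ᶠ[𝓝 t] fun _ ↦ (0 : ℝ) := by
  filter_upwards [Ioi_mem_nhds ht] with s hs using logCutoff_of_four_pow_le hn hs.le

/-- `φ_n` is smooth (`n ≥ 1`). [folklore] -/
theorem logCutoff_contDiff (hn : 1 ≤ n) : ContDiff ℝ ∞ (logCutoff n) := by
  rw [contDiff_iff_contDiffAt]
  intro t
  by_cases ht : 0 < t
  · refine ContDiffAt.congr_of_eventuallyEq ?_ (logCutoff_eventuallyEq_of_pos ht)
    exact plateau_contDiff.contDiffAt.comp t
      ((Real.contDiffAt_log.2 ht.ne').div_const _)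
  · have h2 : t < 2 ^ n := (not_lt.1 ht).trans_lt (by positivity)
    exact contDiffAt_const.congr_of_eventuallyEq (logCutoff_eventuallyEq_one hn h2)

/-- The derivative of `φ_n` on `(0, ∞)` (chain rule). [folklore] -/
theorem hasDerivAt_logCutoff {t : ℝ} (ht : 0 < t) :
    HasDerivAt (logCutoff n)
      (deriv plateau (Real.log t / (n * Real.log 2)) * (t⁻¹ / (n * Real.log 2))) t := by
  have h1 : HasDerivAt (fun s ↦ Real.log s / (n * Real.log 2)) (t⁻¹ / (n * Real.log 2)) t :=
    (Real.hasDerivAt_log ht.ne').div_const _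
  have h2 : HasDerivAt plateau (deriv plateau (Real.log t / (n * Real.log 2)))
      (Real.log t / (n * Real.log 2)) :=
    (plateau_contDiff.differentiable (by simp) _).hasDerivAt
  exact (h2.comp t h1).congr_of_eventuallyEq (logCutoff_eventuallyEq_of_pos ht)

/-- `φ_n' = 0` off the open shell `(2ⁿ, 4ⁿ)` (`n ≥ 1`). [folklore] -/
theorem deriv_logCutoff_eq_zero (hn : 1 ≤ n) {t : ℝ} (ht : t ≤ 2 ^ n ∨ (4 : ℝ) ^ n ≤ t) :
    deriv (logCutoff n) t = 0 := by
  rcases ht with ht | ht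
  · -- `φ_n ≤ 1 = φ_n(t)`: a maximum
    apply IsLocalMax.deriv_eq_zero
    filter_upwards with s
    rw [logCutoff_of_le_two_pow hn ht]
    exact logCutoff_le_one n s
  · apply IsLocalMin.deriv_eq_zero
    filter_upwards with s
    rw [logCutoff_of_four_pow_le hn ht]
    exact logCutoff_nonneg n s

/-- **The derivative bound** `|φ_n'(t)| ≤ c₁ /(n log 2) · t⁻¹` for `t > 0`, with `c₁` the bound
on `|χ'|`. [cite: SchoenYauPMT1979, §2, p. 54] -/
theorem abs_deriv_logCutoff_le {c : ℝ} (hc : ∀ s, |deriv plateau s| ≤ c) (hn : 1 ≤ n) {t : ℝ}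
    (ht : 0 < t) : |deriv (logCutoff n) t| ≤ c / (n * Real.log 2) * t⁻¹ := by
  have hL : 0 < (n : ℝ) * Real.log 2 := by
    have : (1 : ℝ) ≤ n := by exact_mod_cast hn
    positivity
  rw [(hasDerivAt_logCutoff ht).deriv, abs_mul,
    abs_of_nonneg (by positivity : 0 ≤ t⁻¹ / (n * Real.log 2))]
  calc |deriv plateau (Real.log t / (n * Real.log 2))| * (t⁻¹ / (n * Real.log 2))
      ≤ c * (t⁻¹ / (n * Real.log 2)) := by gcongr; exact hc _
    _ = c / (n * Real.log 2) * t⁻¹ := by ring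

/-- **The squared derivative bound with the shell indicator**: for every real `t`,
`φ_n'(t)² ≤ (c₁/(n log 2))² · t⁻² · 𝟙_{2ⁿ < t < 4ⁿ}`. [cite: SchoenYauPMT1979, §2, p. 54] -/
theorem deriv_logCutoff_sq_le {c : ℝ} (hc : ∀ s, |deriv plateau s| ≤ c) (hn : 1 ≤ n) (t : ℝ) :
    deriv (logCutoff n) t ^ 2 ≤
      (c / (n * Real.log 2)) ^ 2 * (Ioo ((2 : ℝ) ^ n) (4 ^ n)).indicator (fun s ↦ (s⁻¹) ^ 2) t := by
  by_cases ht : t ∈ Ioo ((2 : ℝ) ^ n) (4 ^ n)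
  · rw [indicator_of_mem ht, ← mul_pow]
    have h0 : 0 < t := lt_trans (by positivity) ht.1
    calc deriv (logCutoff n) t ^ 2 = |deriv (logCutoff n) t| ^ 2 := (sq_abs _).symm
      _ ≤ (c / (n * Real.log 2) * t⁻¹) ^ 2 :=
        pow_le_pow_left₀ (abs_nonneg _) (abs_deriv_logCutoff_le hc hn h0) 2
  · rw [indicator_of_notMem ht, mul_zero]
    rw [mem_Ioo, not_and_or, not_lt, not_lt] at ht
    rw [deriv_logCutoff_eq_zero hn ht]
    simp


/-! ### Dyadic consequences of quadratic area growth ((2.10), (2.11)) -/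

section Growth

variable {S : Type*} [MeasurableSpace S] {μ : Measure S} {ρ : S → ℝ} {C : ℝ}

/-- `4ᵐ = (2ᵐ)²`. [folklore] -/
theorem four_pow_eq_sq (m : ℕ) : (4 : ℝ) ^ m = (2 ^ m) ^ 2 := by
  rw [show (4 : ℝ) = 2 ^ 2 by norm_num, ← pow_mul, ← pow_mul, mul_comm]

/-- Sublevel sets of the exhaustion have finite measure. [folklore] -/
theorem measure_sublevel_lt_top (hG : ∀ t : ℝ, 1 ≤ t → μ {x | ρ x ≤ t} ≤ ENNReal.ofReal (C * t ^ 2))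
    (t : ℝ) : μ {x | ρ x ≤ t} < ⊤ := by
  have h := hG (max t 1) (le_max_right _ _)
  refine lt_of_le_of_lt (measure_mono fun x (hx : ρ x ≤ t) ↦ ?_) (h.trans_lt ENNReal.ofReal_lt_top)
  exact hx.trans (le_max_left _ _)

/-- The growth bound in real form: `μ.real {ρ ≤ t} ≤ C t²` for `t ≥ 1`. [folklore] -/
theorem measureReal_sublevel_le (hC : 0 ≤ C)
    (hG : ∀ t : ℝ, 1 ≤ t → μ {x | ρ x ≤ t} ≤ ENNReal.ofReal (C * t ^ 2)) {t : ℝ} (ht : 1 ≤ t) :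
    μ.real {x | ρ x ≤ t} ≤ C * t ^ 2 := by
  rw [measureReal_def]
  exact ENNReal.toReal_le_of_le_ofReal (by positivity) (hG t ht)

/-- The measure of a dyadic shell `{2ʲ ≤ ρ < 2ʲ⁺¹}` is at most `C · 4ʲ⁺¹`. [folklore] -/
theorem measureReal_dyadicShell_le (hρ : Measurable ρ) (hC : 0 ≤ C)
    (hG : ∀ t : ℝ, 1 ≤ t → μ {x | ρ x ≤ t} ≤ ENNReal.ofReal (C * t ^ 2)) (j : ℕ) :
    μ.real (ρ ⁻¹' Ico ((2 : ℝ) ^ j) (2 ^ (j + 1))) ≤ C * 4 ^ (j + 1) := by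
  have _ := hρ
  calc μ.real (ρ ⁻¹' Ico ((2 : ℝ) ^ j) (2 ^ (j + 1)))
      ≤ μ.real {x | ρ x ≤ 2 ^ (j + 1)} :=
        measureReal_mono (fun x hx ↦ (mem_Ico.1 hx).2.le) (measure_sublevel_lt_top hG _).ne
    _ ≤ C * (2 ^ (j + 1)) ^ 2 := measureReal_sublevel_le hC hG (one_le_pow₀ one_le_two)
    _ = C * 4 ^ (j + 1) := by rw [four_pow_eq_sq]

/-- Pointwise dyadic domination of `r⁻² 𝟙_{2ⁿ < r < 4ⁿ}` (`r ≥ 1`). [folklore] -/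
theorem indicator_shell_inv_sq_le (n : ℕ) {r : ℝ} (hr1 : 1 ≤ r) :
    (Ioo ((2 : ℝ) ^ n) (4 ^ n)).indicator (fun s ↦ s⁻¹ ^ 2) r ≤
      ∑ k ∈ Finset.range n,
        ((4 : ℝ) ^ (n + k))⁻¹ * (Ico ((2 : ℝ) ^ (n + k)) (2 ^ (n + k + 1))).indicator 1 r := by
  have hnn : ∀ k ∈ Finset.range n,
      0 ≤ ((4 : ℝ) ^ (n + k))⁻¹ * (Ico ((2 : ℝ) ^ (n + k)) (2 ^ (n + k + 1))).indicator 1 r :=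
    fun k _ ↦ mul_nonneg (by positivity) (indicator_nonneg (fun _ _ ↦ zero_le_one) _)
  by_cases hr : r ∈ Ioo ((2 : ℝ) ^ n) (4 ^ n)
  · obtain ⟨j, hj1, hj2⟩ := exists_nat_pow_near hr1 one_lt_two
    have hnj : n ≤ j := by
      have : (2 : ℝ) ^ n < 2 ^ (j + 1) := hr.1.trans hj2
      have := (pow_lt_pow_iff_right₀ (one_lt_two : (1 : ℝ) < 2)).1 this
      omega
    have hj2n : j < 2 * n := by
      have h4 : (4 : ℝ) ^ n = 2 ^ (2 * n) := by rw [pow_mul]; norm_num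
      have : (2 : ℝ) ^ j < 2 ^ (2 * n) := h4 ▸ hj1.trans_lt hr.2
      exact (pow_lt_pow_iff_right₀ (one_lt_two : (1 : ℝ) < 2)).1 this
    have hk : j - n ∈ Finset.range n := by rw [Finset.mem_range]; omega
    have hjk : n + (j - n) = j := by omega
    refine le_trans ?_ (Finset.single_le_sum hnn hk)
    rw [hjk, indicator_of_mem hr, indicator_of_mem (mem_Ico.2 ⟨hj1, hj2⟩), Pi.one_apply, mul_one,
      four_pow_eq_sq, ← inv_pow]
    have h2j : (0 : ℝ) < 2 ^ j := by positivity
    exact pow_le_pow_left₀ (inv_nonneg.2 (zero_le_one.trans hr1)) (inv_anti₀ h2j hj1) 2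
  · rw [indicator_of_notMem hr]
    exact Finset.sum_nonneg hnn

/-- Pointwise dyadic domination of `r⁻³` below `2ᵐ` (`r ≥ 1`). [folklore] -/
theorem inv_cube_le_sum (m : ℕ) {r : ℝ} (hr1 : 1 ≤ r) (hrm : r < 2 ^ m) :
    r⁻¹ ^ 3 ≤ ∑ j ∈ Finset.range m,
        ((8 : ℝ) ^ j)⁻¹ * (Ico ((2 : ℝ) ^ j) (2 ^ (j + 1))).indicator 1 r := by
  have hnn : ∀ j ∈ Finset.range m,
      0 ≤ ((8 : ℝ) ^ j)⁻¹ * (Ico ((2 : ℝ) ^ j) (2 ^ (j + 1))).indicator 1 r :=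
    fun j _ ↦ mul_nonneg (by positivity) (indicator_nonneg (fun _ _ ↦ zero_le_one) _)
  obtain ⟨j, hj1, hj2⟩ := exists_nat_pow_near hr1 one_lt_two
  have hjm : j ∈ Finset.range m := by
    rw [Finset.mem_range]
    exact (pow_lt_pow_iff_right₀ (one_lt_two : (1 : ℝ) < 2)).1 (hj1.trans_lt hrm)
  refine le_trans ?_ (Finset.single_le_sum hnn hjm)
  rw [indicator_of_mem (mem_Ico.2 ⟨hj1, hj2⟩), Pi.one_apply, mul_one,
    show (8 : ℝ) ^ j = (2 ^ j) ^ 3 by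
      rw [show (8 : ℝ) = 2 ^ 3 by norm_num, ← pow_mul, ← pow_mul, mul_comm], ← inv_pow]
  have h2j : (0 : ℝ) < 2 ^ j := by positivity
  exact pow_le_pow_left₀ (inv_nonneg.2 (zero_le_one.trans hr1)) (inv_anti₀ h2j hj1) 3

/-- Integrability and integral of a dyadic indicator combination. [folklore] -/
theorem integral_sum_indicator (hρ : Measurable ρ)
    (hG : ∀ t : ℝ, 1 ≤ t → μ {x | ρ x ≤ t} ≤ ENNReal.ofReal (C * t ^ 2))
    (s : Finset ℕ) (a : ℕ → ℝ) :
    Integrable (fun x ↦ ∑ j ∈ s, a j * (Ico ((2 : ℝ) ^ j) (2 ^ (j + 1))).indicator 1 (ρ x)) μ ∧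
    ∫ x, ∑ j ∈ s, a j * (Ico ((2 : ℝ) ^ j) (2 ^ (j + 1))).indicator 1 (ρ x) ∂μ =
      ∑ j ∈ s, a j * μ.real (ρ ⁻¹' Ico ((2 : ℝ) ^ j) (2 ^ (j + 1))) := by
  have hmeas : ∀ j : ℕ, MeasurableSet (ρ ⁻¹' Ico ((2 : ℝ) ^ j) (2 ^ (j + 1))) :=
    fun j ↦ hρ measurableSet_Ico
  have hfin : ∀ j : ℕ, μ (ρ ⁻¹' Ico ((2 : ℝ) ^ j) (2 ^ (j + 1))) < ⊤ := fun j ↦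
    lt_of_le_of_lt (measure_mono fun x hx ↦ (mem_Ico.1 hx).2.le) (measure_sublevel_lt_top hG _)
  have hind : ∀ j : ℕ, (fun x ↦ (Ico ((2 : ℝ) ^ j) (2 ^ (j + 1))).indicator (1 : ℝ → ℝ) (ρ x)) =
      (ρ ⁻¹' Ico ((2 : ℝ) ^ j) (2 ^ (j + 1))).indicator 1 := by
    intro j; ext x
    simp only [indicator, mem_preimage, Pi.one_apply]
  have hint : ∀ j : ℕ,
      Integrable (fun x ↦ a j * (Ico ((2 : ℝ) ^ j) (2 ^ (j + 1))).indicator 1 (ρ x)) μ := by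
    intro j
    refine Integrable.const_mul ?_ _
    rw [hind j]
    exact (integrable_indicator_iff (hmeas j)).2 (integrableOn_const (hfin j).ne)
  refine ⟨integrable_finsetSum _ fun j _ ↦ hint j, ?_⟩
  rw [integral_finsetSum _ fun j _ ↦ hint j]
  refine Finset.sum_congr rfl fun j _ ↦ ?_
  rw [integral_const_mul, hind j, integral_indicator_one (hmeas j)]

/-- **Schoen–Yau (2.11), dyadic form**: under quadratic area growth,
`∫ ρ⁻² 𝟙_{2ⁿ < ρ < 4ⁿ} dμ ≤ 4 C n` (the printed `∫_{S(σ₂)∖S(σ₁)} r⁻² ≤ 4C₂ log(σ₂/σ₁)`-type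
bound with `σ₁ = 2ⁿ`, `σ₂ = 4ⁿ`). [cite: SchoenYauPMT1979, §2, (2.11)] -/
theorem integral_shell_inv_sq_le (hρ : Measurable ρ) (hρ1 : ∀ x, 1 ≤ ρ x) (hC : 0 ≤ C)
    (hG : ∀ t : ℝ, 1 ≤ t → μ {x | ρ x ≤ t} ≤ ENNReal.ofReal (C * t ^ 2)) (n : ℕ) :
    Integrable (fun x ↦ (Ioo ((2 : ℝ) ^ n) (4 ^ n)).indicator (fun s ↦ s⁻¹ ^ 2) (ρ x)) μ ∧
    ∫ x, (Ioo ((2 : ℝ) ^ n) (4 ^ n)).indicator (fun s ↦ s⁻¹ ^ 2) (ρ x) ∂μ ≤ 4 * C * n := by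
  have hle : ∀ x, (Ioo ((2 : ℝ) ^ n) (4 ^ n)).indicator (fun s ↦ s⁻¹ ^ 2) (ρ x) ≤
      ∑ k ∈ Finset.range n, ((4 : ℝ) ^ (n + k))⁻¹ *
        (Ico ((2 : ℝ) ^ (n + k)) (2 ^ (n + k + 1))).indicator 1 (ρ x) :=
    fun x ↦ indicator_shell_inv_sq_le n (hρ1 x)
  have hnn : ∀ x, 0 ≤ (Ioo ((2 : ℝ) ^ n) (4 ^ n)).indicator (fun s ↦ s⁻¹ ^ 2) (ρ x) :=
    fun x ↦ indicator_nonneg (fun s _ ↦ by positivity) _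
  -- reindex the dominating sum over `j = n + k`
  have hreindex : ∀ x, ∑ k ∈ Finset.range n, ((4 : ℝ) ^ (n + k))⁻¹ *
        (Ico ((2 : ℝ) ^ (n + k)) (2 ^ (n + k + 1))).indicator 1 (ρ x) =
      ∑ j ∈ Finset.Ico n (2 * n), ((4 : ℝ) ^ j)⁻¹ *
        (Ico ((2 : ℝ) ^ j) (2 ^ (j + 1))).indicator (1 : ℝ → ℝ) (ρ x) := by
    intro x
    rw [Finset.sum_Ico_eq_sum_range, show 2 * n - n = n by omega]
  obtain ⟨hgi', hgeq'⟩ := integral_sum_indicator hρ hG (Finset.Ico n (2 * n))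
    (fun j ↦ ((4 : ℝ) ^ j)⁻¹)
  have hmeas : AEStronglyMeasurable
      (fun x ↦ (Ioo ((2 : ℝ) ^ n) (4 ^ n)).indicator (fun s ↦ s⁻¹ ^ 2) (ρ x)) μ := by
    have : Measurable fun s : ℝ ↦ (Ioo ((2 : ℝ) ^ n) (4 ^ n)).indicator (fun s ↦ s⁻¹ ^ 2) s :=
      ((measurable_inv).pow_const 2).indicator measurableSet_Ioo
    exact (this.comp hρ).aestronglyMeasurable
  have hdom : Integrable (fun x ↦ ∑ j ∈ Finset.Ico n (2 * n), ((4 : ℝ) ^ j)⁻¹ *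
        (Ico ((2 : ℝ) ^ j) (2 ^ (j + 1))).indicator (1 : ℝ → ℝ) (ρ x)) μ := hgi'
  refine ⟨hdom.mono' hmeas (Eventually.of_forall fun x ↦ ?_), ?_⟩
  · rw [Real.norm_of_nonneg (hnn x), ← hreindex x]; exact hle x
  calc ∫ x, (Ioo ((2 : ℝ) ^ n) (4 ^ n)).indicator (fun s ↦ s⁻¹ ^ 2) (ρ x) ∂μ
      ≤ ∫ x, ∑ j ∈ Finset.Ico n (2 * n), ((4 : ℝ) ^ j)⁻¹ *
          (Ico ((2 : ℝ) ^ j) (2 ^ (j + 1))).indicator (1 : ℝ → ℝ) (ρ x) ∂μ :=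
        integral_mono_of_nonneg (Eventually.of_forall hnn) hdom
          (Eventually.of_forall fun x ↦ (hle x).trans_eq (hreindex x))
    _ = ∑ j ∈ Finset.Ico n (2 * n), ((4 : ℝ) ^ j)⁻¹ *
          μ.real (ρ ⁻¹' Ico ((2 : ℝ) ^ j) (2 ^ (j + 1))) := hgeq'
    _ ≤ ∑ j ∈ Finset.Ico n (2 * n), 4 * C := by
        refine Finset.sum_le_sum fun j _ ↦ ?_
        calc ((4 : ℝ) ^ j)⁻¹ * μ.real (ρ ⁻¹' Ico ((2 : ℝ) ^ j) (2 ^ (j + 1)))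
            ≤ ((4 : ℝ) ^ j)⁻¹ * (C * 4 ^ (j + 1)) := by
              gcongr; exact measureReal_dyadicShell_le hρ hC hG j
          _ = 4 * C := by rw [pow_succ]; field_simp
    _ = 4 * C * n := by
        rw [Finset.sum_const, Nat.card_Ico, nsmul_eq_mul]
        rw [show 2 * n - n = n by omega]
        ring

/-- **Schoen–Yau (2.10)** (`a = 3`): under quadratic area growth, `∫ ρ⁻³ dμ < ∞`, indeed
`∫ ρ⁻³ dμ ≤ 8C` (dyadic shells: `∫_{2ʲ ≤ ρ < 2ʲ⁺¹} ρ⁻³ ≤ 8⁻ʲ · C 4ʲ⁺¹ = 4C 2⁻ʲ`).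
[cite: SchoenYauPMT1979, §2, (2.10)] -/
theorem integrable_inv_cube (hρ : Measurable ρ) (hρ1 : ∀ x, 1 ≤ ρ x) (hC : 0 ≤ C)
    (hG : ∀ t : ℝ, 1 ≤ t → μ {x | ρ x ≤ t} ≤ ENNReal.ofReal (C * t ^ 2)) :
    Integrable (fun x ↦ (ρ x)⁻¹ ^ 3) μ ∧ ∫ x, (ρ x)⁻¹ ^ 3 ∂μ ≤ 8 * C := by
  -- the exhaustion `{ρ < 2ᵐ}`
  have hcover : AECover μ atTop (fun m : ℕ ↦ ρ ⁻¹' Iio ((2 : ℝ) ^ m)) :=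
    { ae_eventually_mem := Eventually.of_forall fun x ↦
        ((tendsto_pow_atTop_atTop_of_one_lt one_lt_two).eventually_gt_atTop (ρ x)).mono
          fun m hm ↦ hm
      measurableSet := fun m ↦ hρ measurableSet_Iio }
  have hmeas : Measurable fun x ↦ (ρ x)⁻¹ ^ 3 := (hρ.inv).pow_const 3
  have hnn : ∀ x, 0 ≤ (ρ x)⁻¹ ^ 3 := fun x ↦ by have := hρ1 x; positivity
  have hle1 : ∀ x, (ρ x)⁻¹ ^ 3 ≤ 1 := fun x ↦
    pow_le_one₀ (by have := hρ1 x; positivity) (inv_le_one_of_one_le₀ (hρ1 x))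
  have hfin : ∀ m : ℕ, μ (ρ ⁻¹' Iio ((2 : ℝ) ^ m)) < ⊤ := fun m ↦
    lt_of_le_of_lt (measure_mono fun x (hx : ρ x < 2 ^ m) ↦ (show ρ x ≤ 2 ^ m from hx.le))
      (measure_sublevel_lt_top hG _)
  have hion : ∀ m : ℕ, IntegrableOn (fun x ↦ (ρ x)⁻¹ ^ 3) (ρ ⁻¹' Iio ((2 : ℝ) ^ m)) μ := by
    intro m
    refine Measure.integrableOn_of_bounded (M := 1) (hfin m).ne hmeas.aestronglyMeasurable ?_
    exact Eventually.of_forall fun x ↦ by rw [Real.norm_of_nonneg (hnn x)]; exact hle1 x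
  have hbound : ∀ m : ℕ, ∫ x in ρ ⁻¹' Iio ((2 : ℝ) ^ m), (ρ x)⁻¹ ^ 3 ∂μ ≤ 8 * C := by
    intro m
    obtain ⟨hgi, hgeq⟩ := integral_sum_indicator hρ hG (Finset.range m) (fun j ↦ ((8 : ℝ) ^ j)⁻¹)
    rw [← integral_indicator (hρ measurableSet_Iio)]
    have hle : ∀ x, (ρ ⁻¹' Iio ((2 : ℝ) ^ m)).indicator (fun x ↦ (ρ x)⁻¹ ^ 3) x ≤
        ∑ j ∈ Finset.range m, ((8 : ℝ) ^ j)⁻¹ *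
          (Ico ((2 : ℝ) ^ j) (2 ^ (j + 1))).indicator 1 (ρ x) := by
      intro x
      by_cases hx : x ∈ ρ ⁻¹' Iio ((2 : ℝ) ^ m)
      · rw [indicator_of_mem hx]; exact inv_cube_le_sum m (hρ1 x) hx
      · rw [indicator_of_notMem hx]
        exact Finset.sum_nonneg fun j _ ↦
          mul_nonneg (by positivity) (indicator_nonneg (fun _ _ ↦ zero_le_one) _)
    calc ∫ x, (ρ ⁻¹' Iio ((2 : ℝ) ^ m)).indicator (fun x ↦ (ρ x)⁻¹ ^ 3) x ∂μ
        ≤ ∫ x, ∑ j ∈ Finset.range m, ((8 : ℝ) ^ j)⁻¹ *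
            (Ico ((2 : ℝ) ^ j) (2 ^ (j + 1))).indicator 1 (ρ x) ∂μ :=
          integral_mono_of_nonneg
            (Eventually.of_forall fun x ↦ indicator_nonneg (fun x _ ↦ hnn x) _) hgi
            (Eventually.of_forall hle)
      _ = ∑ j ∈ Finset.range m, ((8 : ℝ) ^ j)⁻¹ *
            μ.real (ρ ⁻¹' Ico ((2 : ℝ) ^ j) (2 ^ (j + 1))) := hgeq
      _ ≤ ∑ j ∈ Finset.range m, 4 * C * (1 / 2) ^ j := by
          refine Finset.sum_le_sum fun j _ ↦ ?_
          calc ((8 : ℝ) ^ j)⁻¹ * μ.real (ρ ⁻¹' Ico ((2 : ℝ) ^ j) (2 ^ (j + 1)))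
              ≤ ((8 : ℝ) ^ j)⁻¹ * (C * 4 ^ (j + 1)) := by
                gcongr; exact measureReal_dyadicShell_le hρ hC hG j
            _ = 4 * C * (1 / 2) ^ j := by
                rw [pow_succ, show (8 : ℝ) = 4 * 2 by norm_num, mul_pow, one_div, inv_pow]
                field_simp
      _ = 4 * C * ∑ j ∈ Finset.range m, (1 / 2 : ℝ) ^ j := by rw [Finset.mul_sum]
      _ ≤ 4 * C * 2 := by gcongr; exact sum_geometric_two_le m
      _ = 8 * C := by ring
  have hint : Integrable (fun x ↦ (ρ x)⁻¹ ^ 3) μ :=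
    hcover.integrable_of_integral_bounded_of_nonneg_ae (8 * C) hion
      (Eventually.of_forall hnn) (Eventually.of_forall hbound)
  exact ⟨hint, le_of_tendsto' (hcover.integral_tendsto_of_countably_generated hint)
    hbound⟩

end Growth


/-! ### The cut-off argument: the stability inequality against radial test functions -/

section Stability

variable {S : Type*} [MeasurableSpace S] {μ : Measure S} {ρ : S → ℝ} {C Λ : ℝ}

/-- **The energy of the logarithmic cut-offs tends to zero** (Schoen–Yau 1979, p. 54: by
(2.11), `∫_S ‖∇φ‖² ≤ C₃ (log σ)⁻² ∫_{S(σ²)∖S(σ)} r⁻² → 0`): under quadratic area growth,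
`∫ φ_n'(ρ)² dμ ≤ (4 C c₁²/(log 2)²)/n`. [cite: SchoenYauPMT1979, §2, p. 54] -/
theorem integral_deriv_logCutoff_sq_le (hρ : Measurable ρ) (hρ1 : ∀ x, 1 ≤ ρ x) (hC : 0 ≤ C)
    (hG : ∀ t : ℝ, 1 ≤ t → μ {x | ρ x ≤ t} ≤ ENNReal.ofReal (C * t ^ 2))
    {c : ℝ} (hc : ∀ s, |deriv plateau s| ≤ c) {n : ℕ} (hn : 1 ≤ n) :
    Integrable (fun x ↦ deriv (logCutoff n) (ρ x) ^ 2) μ ∧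
    ∫ x, deriv (logCutoff n) (ρ x) ^ 2 ∂μ ≤ (4 * C * c ^ 2 / Real.log 2 ^ 2) / n := by
  obtain ⟨hI, hIle⟩ := integral_shell_inv_sq_le hρ hρ1 hC hG n
  have hle : ∀ x, deriv (logCutoff n) (ρ x) ^ 2 ≤ (c / (n * Real.log 2)) ^ 2 *
      (Ioo ((2 : ℝ) ^ n) (4 ^ n)).indicator (fun s ↦ s⁻¹ ^ 2) (ρ x) :=
    fun x ↦ deriv_logCutoff_sq_le hc hn (ρ x)
  have hmeas : AEStronglyMeasurable (fun x ↦ deriv (logCutoff n) (ρ x) ^ 2) μ :=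
    ((((logCutoff_contDiff hn).continuous_deriv (by simp)).measurable.comp hρ).pow_const
      2).aestronglyMeasurable
  have hdom : Integrable (fun x ↦ (c / (n * Real.log 2)) ^ 2 *
      (Ioo ((2 : ℝ) ^ n) (4 ^ n)).indicator (fun s ↦ s⁻¹ ^ 2) (ρ x)) μ := hI.const_mul _
  refine ⟨hdom.mono' hmeas (Eventually.of_forall fun x ↦ ?_), ?_⟩
  · rw [Real.norm_of_nonneg (sq_nonneg _)]; exact hle x
  have hn' : (0 : ℝ) < n := by exact_mod_cast hn
  have hL : 0 < Real.log 2 := Real.log_pos one_lt_two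
  calc ∫ x, deriv (logCutoff n) (ρ x) ^ 2 ∂μ
      ≤ ∫ x, (c / (n * Real.log 2)) ^ 2 *
          (Ioo ((2 : ℝ) ^ n) (4 ^ n)).indicator (fun s ↦ s⁻¹ ^ 2) (ρ x) ∂μ :=
        integral_mono_of_nonneg (Eventually.of_forall fun x ↦ sq_nonneg _) hdom
          (Eventually.of_forall hle)
    _ = (c / (n * Real.log 2)) ^ 2 *
          ∫ x, (Ioo ((2 : ℝ) ^ n) (4 ^ n)).indicator (fun s ↦ s⁻¹ ^ 2) (ρ x) ∂μ :=
        integral_const_mul _ _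
    _ ≤ (c / (n * Real.log 2)) ^ 2 * (4 * C * n) := by gcongr
    _ = (4 * C * c ^ 2 / Real.log 2 ^ 2) / n := by field_simp

/-- The sublevel sets `{ρ ≤ 2ᵐ}` exhaust `S` (an `AECover` along `m → ∞`). [folklore] -/
theorem aecover_sublevel_two_pow (hρ : Measurable ρ) :
    AECover μ atTop (fun m : ℕ ↦ {x | ρ x ≤ (2 : ℝ) ^ m}) :=
  { ae_eventually_mem := Eventually.of_forall fun x ↦
      ((tendsto_pow_atTop_atTop_of_one_lt one_lt_two).eventually_ge_atTop (ρ x)).mono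
        fun _ hm ↦ hm
    measurableSet := fun _ ↦ hρ measurableSet_Iic }

/-- A locally integrable `P` times the compactly supported `φ_n(ρ)²` is integrable. [folklore] -/
theorem integrable_mul_logCutoff_sq (hρ : Measurable ρ) {P : S → ℝ}
    (hPloc : ∀ t : ℝ, IntegrableOn P {x | ρ x ≤ t} μ) {n : ℕ} (hn : 1 ≤ n) :
    Integrable (fun x ↦ P x * logCutoff n (ρ x) ^ 2) μ := by
  have heq : (fun x ↦ P x * logCutoff n (ρ x) ^ 2) =
      fun x ↦ ({x | ρ x ≤ (4 : ℝ) ^ n}.indicator P) x * logCutoff n (ρ x) ^ 2 := by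
    funext x
    by_cases hx : x ∈ {x | ρ x ≤ (4 : ℝ) ^ n}
    · rw [indicator_of_mem hx]
    · rw [indicator_of_notMem hx, zero_mul,
        logCutoff_of_four_pow_le hn (le_of_not_ge hx), zero_pow two_ne_zero, mul_zero]
  rw [heq]
  refine Integrable.mul_bdd (c := 1) ?_ ?_ (Eventually.of_forall fun x ↦ ?_)
  · exact (integrable_indicator_iff (hρ measurableSet_Iic)).2 (hPloc _)
  · exact ((((logCutoff_contDiff hn).continuous).measurable.comp hρ).pow_const
      2).aestronglyMeasurable
  · rw [Real.norm_of_nonneg (sq_nonneg _), pow_le_one_iff_of_nonneg (logCutoff_nonneg _ _)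
      two_ne_zero]
    exact logCutoff_le_one _ _

/-- `∫ P φ_n(ρ)² → ∫ P` for integrable `P` (dominated convergence; `φ_n(ρ x) = 1` eventually).
[folklore] -/
theorem tendsto_integral_mul_logCutoff_sq {P : S → ℝ} (hρ : Measurable ρ) (hP : Integrable P μ) :
    Tendsto (fun n : ℕ ↦ ∫ x, P x * logCutoff n (ρ x) ^ 2 ∂μ) atTop (𝓝 (∫ x, P x ∂μ)) := by
  refine tendsto_integral_filter_of_dominated_convergence (fun x ↦ ‖P x‖) ?_ ?_ hP.norm ?_
  · filter_upwards [eventually_ge_atTop 1] with n hn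
    exact hP.aestronglyMeasurable.mul
      ((((logCutoff_contDiff hn).continuous).measurable.comp hρ).pow_const 2).aestronglyMeasurable
  · filter_upwards with n
    filter_upwards with x
    rw [norm_mul, norm_pow, Real.norm_of_nonneg (logCutoff_nonneg _ _)]
    exact mul_le_of_le_one_right (norm_nonneg _) (pow_le_one₀ (logCutoff_nonneg _ _)
      (logCutoff_le_one _ _))
  · filter_upwards with x
    refine tendsto_const_nhds.congr' ?_
    filter_upwards [eventually_ge_atTop 1,
      (tendsto_pow_atTop_atTop_of_one_lt one_lt_two).eventually_ge_atTop (ρ x)] with n hn hx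
    rw [logCutoff_of_le_two_pow hn hx, one_pow, mul_one]

/-- **The logarithmic cut-off argument** (Schoen–Yau 1979, §2, pp. 54–55, abstract form).
Let `(S, μ)` be a measure space with an exhaustion `ρ ≥ 1` of *quadratic area growth*,
`μ{ρ ≤ t} ≤ C t²` for `t ≥ 1` ((2.9)), `P ≥ 0` locally integrable along the exhaustion, and
`Q` integrable. Suppose the *stability inequality* `∫ (P − Q) η(ρ)² dμ ≤ Λ ∫ η'(ρ)² dμ` holds for
every smooth profile `η : ℝ → [0, 1]` with `η = 1` on `(-∞, 1]` and `η = 0` on some `[T, ∞)`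
(the shape in which (2.13)/(2.15) are used with `f = φ(r)` a radial cut-off, `‖∇f‖² ≤ C₃ φ'(r)²`).
Then `P` is integrable and `∫ P dμ ≤ ∫ Q dμ`: with the logarithmic cut-offs `φ_n`
(`logCutoff`), `∫_{ρ ≤ 2ⁿ} P ≤ ∫ P φ_n(ρ)² ≤ ∫ Q φ_n(ρ)² + |Λ| K₀/n` is bounded, so `P ∈ L¹`
(monotone exhaustion), and letting `n → ∞` (dominated convergence on both sides, the cut-off
energy `→ 0` by (2.11)) gives the inequality — the passage "letting `σ → ∞` we conclude" of
p. 54 ((2.16)) and p. 55 ((2.18)). [cite: SchoenYauPMT1979, §2, pp. 54–55, (2.16)–(2.18)] -/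
theorem integrable_and_integral_le_of_stability (hρ : Measurable ρ) (hρ1 : ∀ x, 1 ≤ ρ x)
    (hC : 0 ≤ C) (hG : ∀ t : ℝ, 1 ≤ t → μ {x | ρ x ≤ t} ≤ ENNReal.ofReal (C * t ^ 2))
    {P Q : S → ℝ} (hP0 : ∀ x, 0 ≤ P x) (hPloc : ∀ t : ℝ, IntegrableOn P {x | ρ x ≤ t} μ)
    (hQ : Integrable Q μ)
    (hstab : ∀ (η : ℝ → ℝ) (T : ℝ), ContDiff ℝ ∞ η → (∀ t, η t ∈ Icc (0 : ℝ) 1) →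
      (∀ t ≤ 1, η t = 1) → (∀ t, T ≤ t → η t = 0) →
      ∫ x, (P x - Q x) * η (ρ x) ^ 2 ∂μ ≤ Λ * ∫ x, deriv η (ρ x) ^ 2 ∂μ) :
    Integrable P μ ∧ ∫ x, P x ∂μ ≤ ∫ x, Q x ∂μ := by
  obtain ⟨c, -, hc⟩ := exists_bound_deriv_plateau
  set K₀ : ℝ := 4 * C * c ^ 2 / Real.log 2 ^ 2 with hK₀
  have hK₀0 : 0 ≤ K₀ := by positivity
  -- the basic inequality `∫ P φ_n² ≤ ∫ Q φ_n² + |Λ| K₀ / n`, `n ≥ 1`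
  have hPint : ∀ {n : ℕ}, 1 ≤ n → Integrable (fun x ↦ P x * logCutoff n (ρ x) ^ 2) μ :=
    fun hn ↦ integrable_mul_logCutoff_sq hρ hPloc hn
  have hQint : ∀ {n : ℕ}, 1 ≤ n → Integrable (fun x ↦ Q x * logCutoff n (ρ x) ^ 2) μ :=
    fun hn ↦ integrable_mul_logCutoff_sq hρ (fun t ↦ hQ.integrableOn) hn
  have hkey : ∀ {n : ℕ}, 1 ≤ n →
      ∫ x, P x * logCutoff n (ρ x) ^ 2 ∂μ ≤
        ∫ x, Q x * logCutoff n (ρ x) ^ 2 ∂μ + |Λ| * (K₀ / n) := by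
    intro n hn
    have h := hstab (logCutoff n) ((4 : ℝ) ^ n) (logCutoff_contDiff hn) (logCutoff_mem_Icc n)
      (fun t ht ↦ logCutoff_of_le_two_pow hn (ht.trans (one_le_pow₀ one_le_two)))
      (fun t ht ↦ logCutoff_of_four_pow_le hn ht)
    have hsub : ∫ x, (P x - Q x) * logCutoff n (ρ x) ^ 2 ∂μ =
        ∫ x, P x * logCutoff n (ρ x) ^ 2 ∂μ - ∫ x, Q x * logCutoff n (ρ x) ^ 2 ∂μ := by
      rw [← integral_sub (hPint hn) (hQint hn)]
      congr 1; funext x; ring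
    obtain ⟨-, hE⟩ := integral_deriv_logCutoff_sq_le hρ hρ1 hC hG hc hn
    have hE0 : 0 ≤ ∫ x, deriv (logCutoff n) (ρ x) ^ 2 ∂μ := integral_nonneg fun x ↦ sq_nonneg _
    have hΛ : Λ * ∫ x, deriv (logCutoff n) (ρ x) ^ 2 ∂μ ≤ |Λ| * (K₀ / n) :=
      (mul_le_mul_of_nonneg_right (le_abs_self Λ) hE0).trans
        (mul_le_mul_of_nonneg_left hE (abs_nonneg Λ))
    linarith
  -- Step 1: `P` is integrable
  have hcover := aecover_sublevel_two_pow (μ := μ) hρ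
  have hB : ∀ {n : ℕ}, 1 ≤ n →
      ∫ x in {x | ρ x ≤ (2 : ℝ) ^ n}, P x ∂μ ≤ ∫ x, |Q x| ∂μ + |Λ| * K₀ := by
    intro n hn
    have hms : MeasurableSet {x | ρ x ≤ (2 : ℝ) ^ n} := hρ measurableSet_Iic
    have h1 : ∫ x in {x | ρ x ≤ (2 : ℝ) ^ n}, P x ∂μ ≤ ∫ x, P x * logCutoff n (ρ x) ^ 2 ∂μ := by
      rw [← integral_indicator hms]
      refine integral_mono ((integrable_indicator_iff hms).2 (hPloc _))
        (hPint hn) fun x ↦ ?_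
      by_cases hx : x ∈ {x | ρ x ≤ (2 : ℝ) ^ n}
      · rw [indicator_of_mem hx, logCutoff_of_le_two_pow hn hx, one_pow, mul_one]
      · rw [indicator_of_notMem hx]
        exact mul_nonneg (hP0 x) (sq_nonneg _)
    have h2 : ∫ x, Q x * logCutoff n (ρ x) ^ 2 ∂μ ≤ ∫ x, |Q x| ∂μ := by
      refine integral_mono (hQint hn) hQ.abs fun x ↦ ?_
      calc Q x * logCutoff n (ρ x) ^ 2 ≤ |Q x| * logCutoff n (ρ x) ^ 2 :=
            mul_le_mul_of_nonneg_right (le_abs_self _) (sq_nonneg _)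
        _ ≤ |Q x| * 1 := mul_le_mul_of_nonneg_left
            (pow_le_one₀ (logCutoff_nonneg _ _) (logCutoff_le_one _ _)) (abs_nonneg _)
        _ = |Q x| := mul_one _
    have h3 : |Λ| * (K₀ / n) ≤ |Λ| * K₀ := by
      refine mul_le_mul_of_nonneg_left (div_le_self hK₀0 (by exact_mod_cast hn)) (abs_nonneg _)
    linarith [hkey hn]
  have hP : Integrable P μ :=
    hcover.integrable_of_integral_bounded_of_nonneg_ae _ (fun m ↦ hPloc _)
      (Eventually.of_forall hP0) ((eventually_ge_atTop 1).mono fun n hn ↦ hB hn)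
  -- Step 2: the sharp inequality by dominated convergence
  refine ⟨hP, ?_⟩
  have hlimP := tendsto_integral_mul_logCutoff_sq hρ hP
  have hlimQ : Tendsto (fun n : ℕ ↦ ∫ x, Q x * logCutoff n (ρ x) ^ 2 ∂μ + |Λ| * (K₀ / n)) atTop
      (𝓝 (∫ x, Q x ∂μ)) := by
    have h0 : Tendsto (fun n : ℕ ↦ |Λ| * (K₀ / n)) atTop (𝓝 0) := by
      simpa using (tendsto_const_div_atTop_nhds_zero_nat K₀).const_mul |Λ|
    simpa using (tendsto_integral_mul_logCutoff_sq hρ hQ).add h0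
  exact le_of_tendsto_of_tendsto hlimP hlimQ ((eventually_ge_atTop 1).mono fun n hn ↦ hkey hn)

/-- **Schoen–Yau 1979, §2, Step 3, (2.15) ⟹ (2.16)–(2.18)** (abstract form of pp. 54–55). On a
measure space `(S, μ)` (the minimal surface with its area measure) with an exhaustion `ρ ≥ 1`
(the extended coordinate radius `r'`) of quadratic area growth `μ{ρ ≤ t} ≤ C t²` ((2.9)), let
`R ≥ 0` (ambient scalar curvature along `S`), `a ≥ 0` (`‖A‖²`, the squared second fundamental
form) be locally integrable along the exhaustion and `K` (the Gauss curvature of `S`) be such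
that `K + a/2` is integrable (by the Gauss equation (2.14) and minimality, `K + ‖A‖²/2 = K₁₂`,
the ambient sectional curvature of `TS`, which is `O(r⁻³)` by (1.1), integrable by (2.10) —
see `integrable_inv_cube` and the primed version below). Assume the inequality (2.15),
`∫_S (R/2 − K + ‖A‖²/2) f² ≤ ∫_S ‖∇f‖²`, in the form it is used: for the radial test functions
`f = η(ρ)` with `η : ℝ → [0, 1]` smooth, `η = 1` on `(-∞, 1]`, `η = 0` on some `[T, ∞)`, with
`‖∇f‖² ≤ Λ η'(ρ)²` absorbed into the constant: `∫ (R/2 − K + a/2) η(ρ)² dμ ≤ Λ ∫ η'(ρ)² dμ`.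
Then: `a ∈ L¹` ((2.16): `∫_S ‖A‖² < ∞`), `K ∈ L¹` ((2.17): `∫_S |K| < ∞`), `R ∈ L¹`, and
`½ ∫ (R + a) dμ ≤ ∫ K dμ`; if moreover `R > 0` on a set of positive measure ("`R > 0` outside a
compact subset of `S`", `S` non-compact), then `0 < ½ ∫ (R + ‖A‖²) ≤ ∫ K` ((2.18)).
[cite: SchoenYauPMT1979, §2, pp. 54–55, (2.15)–(2.18)] -/
theorem integral_gauss_curvature_pos_of_stability (hρ : Measurable ρ) (hρ1 : ∀ x, 1 ≤ ρ x)
    (hC : 0 ≤ C) (hG : ∀ t : ℝ, 1 ≤ t → μ {x | ρ x ≤ t} ≤ ENNReal.ofReal (C * t ^ 2))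
    {R a K : S → ℝ} (hR0 : ∀ x, 0 ≤ R x) (ha0 : ∀ x, 0 ≤ a x)
    (hRloc : ∀ t : ℝ, IntegrableOn R {x | ρ x ≤ t} μ)
    (haloc : ∀ t : ℝ, IntegrableOn a {x | ρ x ≤ t} μ)
    (hK12 : Integrable (fun x ↦ K x + a x / 2) μ)
    (hstab : ∀ (η : ℝ → ℝ) (T : ℝ), ContDiff ℝ ∞ η → (∀ t, η t ∈ Icc (0 : ℝ) 1) →
      (∀ t ≤ 1, η t = 1) → (∀ t, T ≤ t → η t = 0) →
      ∫ x, (R x / 2 - K x + a x / 2) * η (ρ x) ^ 2 ∂μ ≤ Λ * ∫ x, deriv η (ρ x) ^ 2 ∂μ) :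
    Integrable R μ ∧ Integrable a μ ∧ Integrable K μ ∧
      (1 / 2) * ∫ x, (R x + a x) ∂μ ≤ ∫ x, K x ∂μ ∧
      (μ {x | 0 < R x} ≠ 0 → 0 < (1 / 2) * ∫ x, (R x + a x) ∂μ) := by
  -- `P = R/2 + a ≥ 0`, `Q = K + a/2`, `P − Q = R/2 − K + a/2`
  have hmain := integrable_and_integral_le_of_stability (Λ := Λ) hρ hρ1 hC hG
    (P := fun x ↦ R x / 2 + a x) (Q := fun x ↦ K x + a x / 2)
    (fun x ↦ by have := hR0 x; have := ha0 x; positivity)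
    (fun t ↦ ((hRloc t).div_const 2).add (haloc t)) hK12 (by
      intro η T hη h01 h1 hT
      calc ∫ x, ((R x / 2 + a x) - (K x + a x / 2)) * η (ρ x) ^ 2 ∂μ
          = ∫ x, (R x / 2 - K x + a x / 2) * η (ρ x) ^ 2 ∂μ := by
            congr 1; funext x; ring
        _ ≤ _ := hstab η T hη h01 h1 hT)
  obtain ⟨hP, hPQ⟩ := hmain
  have hPm := hP.aestronglyMeasurable
  -- integrability of `R`, `a`, `K`
  have hRm : AEStronglyMeasurable R μ :=
    (aecover_sublevel_two_pow (μ := μ) hρ).aestronglyMeasurable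
      fun m ↦ (hRloc _).aestronglyMeasurable
  have ham : AEStronglyMeasurable a μ :=
    (aecover_sublevel_two_pow (μ := μ) hρ).aestronglyMeasurable
      fun m ↦ (haloc _).aestronglyMeasurable
  have hR : Integrable R μ := by
    have h2 : Integrable (fun x ↦ 2 * (R x / 2 + a x)) μ := hP.const_mul 2
    refine h2.mono' hRm (Eventually.of_forall fun x ↦ ?_)
    rw [Real.norm_of_nonneg (hR0 x)]
    linarith [ha0 x]
  have ha : Integrable a μ := by
    refine hP.mono' ham (Eventually.of_forall fun x ↦ ?_)
    rw [Real.norm_of_nonneg (ha0 x)]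
    linarith [hR0 x]
  have hK : Integrable K μ := by
    have : (fun x ↦ K x) = fun x ↦ (K x + a x / 2) - a x / 2 := by funext x; ring
    rw [show K = fun x ↦ K x from rfl, this]
    exact hK12.sub (ha.div_const 2)
  refine ⟨hR, ha, hK, ?_, fun hpos ↦ ?_⟩
  · -- `∫ (R/2 + a) ≤ ∫ (K + a/2)` rearranged
    have h1 : ∫ x, (R x / 2 + a x) ∂μ = (1 / 2) * ∫ x, R x ∂μ + ∫ x, a x ∂μ := by
      rw [integral_add (hR.div_const 2) ha, integral_div]; ring
    have h2 : ∫ x, (K x + a x / 2) ∂μ = ∫ x, K x ∂μ + (1 / 2) * ∫ x, a x ∂μ := by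
      rw [integral_add hK (ha.div_const 2), integral_div]; ring
    rw [integral_add hR ha]
    linarith
  · -- strictness from `μ{R > 0} ≠ 0`
    have hRpos : 0 < ∫ x, R x ∂μ := by
      rw [integral_pos_iff_support_of_nonneg hR0 hR]
      have : Function.support R = {x | 0 < R x} := by
        ext x
        simp only [Function.mem_support, mem_setOf_eq]
        exact ⟨fun h ↦ lt_of_le_of_ne (hR0 x) (Ne.symm h), fun h ↦ h.ne'⟩
      rw [this]
      exact pos_iff_ne_zero.2 hpos
    rw [integral_add hR ha]
    have ha_nn : 0 ≤ ∫ x, a x ∂μ := integral_nonneg (μ := μ) (f := a) fun x ↦ ha0 x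
    linarith

/-- **The same with the curvature decay as printed**: `|K + ‖A‖²/2| = |K₁₂| ≤ Λ' r⁻³` ((2.14) with
`h₁₁ + h₂₂ = 0`, and `K₁₂ = O(r⁻³)` by (1.1)), integrable by (2.10) (`integrable_inv_cube`).
[cite: SchoenYauPMT1979, §2, pp. 54–55, (2.10), (2.14)–(2.18)] -/
theorem integral_gauss_curvature_pos_of_stability' (hρ : Measurable ρ) (hρ1 : ∀ x, 1 ≤ ρ x)
    (hC : 0 ≤ C) (hG : ∀ t : ℝ, 1 ≤ t → μ {x | ρ x ≤ t} ≤ ENNReal.ofReal (C * t ^ 2))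
    {R a K : S → ℝ} {Λ' : ℝ} (hR0 : ∀ x, 0 ≤ R x) (ha0 : ∀ x, 0 ≤ a x)
    (hRloc : ∀ t : ℝ, IntegrableOn R {x | ρ x ≤ t} μ)
    (haloc : ∀ t : ℝ, IntegrableOn a {x | ρ x ≤ t} μ)
    (hKm : AEStronglyMeasurable K μ) (hK12 : ∀ x, |K x + a x / 2| ≤ Λ' * (ρ x)⁻¹ ^ 3)
    (hstab : ∀ (η : ℝ → ℝ) (T : ℝ), ContDiff ℝ ∞ η → (∀ t, η t ∈ Icc (0 : ℝ) 1) →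
      (∀ t ≤ 1, η t = 1) → (∀ t, T ≤ t → η t = 0) →
      ∫ x, (R x / 2 - K x + a x / 2) * η (ρ x) ^ 2 ∂μ ≤ Λ * ∫ x, deriv η (ρ x) ^ 2 ∂μ) :
    Integrable R μ ∧ Integrable a μ ∧ Integrable K μ ∧
      (1 / 2) * ∫ x, (R x + a x) ∂μ ≤ ∫ x, K x ∂μ ∧
      (μ {x | 0 < R x} ≠ 0 → 0 < (1 / 2) * ∫ x, (R x + a x) ∂μ) := by
  refine integral_gauss_curvature_pos_of_stability hρ hρ1 hC hG hR0 ha0 hRloc haloc ?_ hstab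
  have ham : AEStronglyMeasurable a μ :=
    (aecover_sublevel_two_pow (μ := μ) hρ).aestronglyMeasurable
      fun m ↦ (haloc _).aestronglyMeasurable
  refine ((integrable_inv_cube hρ hρ1 hC hG).1.const_mul Λ').mono'
    (hKm.aemeasurable.add (ham.aemeasurable.div_const 2)).aestronglyMeasurable
    (Eventually.of_forall fun x ↦ ?_)
  rw [Real.norm_eq_abs]
  exact hK12 x

end Stability

end SchoenYau

end Literature.Geometry.Lorentzian

end
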